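import Mathlib

/-!
# Route `BECHeatBathGap` — support item `JastrowDobrushinRung` (stmt-AtomisticToContinuum-14373):
# one-site resampling and the heat-bath operator (helper file 1)

Helpers for the proof of
`Summit.AtomisticToContinuum.BoseEinsteinCondensation.Theses.BECHeatBathGap.JastrowDobrushinRung`
(approximate tensorisation of variance with constant 2 for the Jastrow law under
`5N∫(1-f²) ≤ L³`, via Dobrushin uniqueness ⇒ heat-bath spectral gap, Wu 2006).

This file: on a finite product `E^ι` of a probability space `(E, u)`,
* the resampling identity `map_update_pi_prod` / `integral_eq_integral_integral_update`
  (resampling one coordinate independently from `u` preserves `u^{⊗ι}`);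
* the one-site averaging operator `S j G (X) = ∫ G(X[j ↦ y]) du(y)` and the heat-bath
  (Gibbs-sampler) operator `T j F = S j (F π_j) / S j π_j` of a one-site weight `π_j`, with their
  elementary algebra (measurability, bounds, invariance, linearity).

Design: `S` and `T` are passed as variables together with their defining equations `hS`, `hT`
(no auxiliary definitions are introduced), as in `Literature.Probability.Moments.EfronSteinProofs`.
-/

noncomputable section

namespace Summit.AtomisticToContinuum.BoseEinsteinCondensation.Theorems

namespace JastrowDobrushin

open MeasureTheory Function
open scoped ENNReal

variable {ι : Type*} [DecidableEq ι] {E : Type*} [MeasurableSpace E]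
  {u : Measure E} {S : ι → ((ι → E) → ℝ) → (ι → E) → ℝ}

/-! ### Resampling one coordinate of a product probability measure -/

/-- Resampling coordinate `j` of a `u^{⊗ι}`-distributed vector independently from `u` does not
change its law: the push-forward of `u^{⊗ι} ⊗ u` under `(X, y) ↦ X[j ↦ y]` is `u^{⊗ι}`
(`u` a probability measure). [folklore] -/
theorem map_update_pi_prod [Fintype ι] [IsProbabilityMeasure u] (j : ι) :
    Measure.map (fun p : (ι → E) × E => update p.1 j p.2)
        ((Measure.pi fun _ : ι => u).prod u) = Measure.pi fun _ : ι => u := by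
  refine Measure.ext_of_lintegral _ fun φ hφ => ?_
  rw [lintegral_map hφ measurable_update',
    lintegral_prod (fun p : (ι → E) × E => φ (update p.1 j p.2))
      (hφ.comp measurable_update').aemeasurable]
  have key : lmarginal (fun _ : ι => u) {j} (lmarginal (fun _ : ι => u) {j} φ) =
      lmarginal (fun _ : ι => u) {j} φ := by
    ext X
    rw [lmarginal_singleton (lmarginal (fun _ : ι => u) {j} φ) j]
    simp_rw [lmarginal_update_of_mem (μ := fun _ : ι => u) (Finset.mem_singleton_self j)]
    rw [lintegral_const, measure_univ, mul_one]
  calc ∫⁻ X, ∫⁻ y, φ (update X j y) ∂u ∂(Measure.pi fun _ : ι => u)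
      = ∫⁻ X, lmarginal (fun _ : ι => u) {j} φ X ∂(Measure.pi fun _ : ι => u) := by
        simp_rw [lmarginal_singleton]
    _ = ∫⁻ X, φ X ∂(Measure.pi fun _ : ι => u) :=
        lintegral_eq_of_lmarginal_eq {j} (hφ.lmarginal _) hφ key

/-- **Resampling identity** for Bochner integrals: for `G` integrable against `u^{⊗ι}`,
`∫ G = ∫ (∫ G(X[j ↦ y]) du(y)) du^{⊗ι}(X)`. [folklore] -/
theorem integral_eq_integral_integral_update [Fintype ι] [IsProbabilityMeasure u] (j : ι)
    {G : (ι → E) → ℝ} (hG : Integrable G (Measure.pi fun _ : ι => u)) :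
    ∫ X, G X ∂(Measure.pi fun _ : ι => u) =
      ∫ X, ∫ y, G (update X j y) ∂u ∂(Measure.pi fun _ : ι => u) := by
  have hmap := map_update_pi_prod (u := u) j
  have hGm : AEStronglyMeasurable G
      (Measure.map (fun p : (ι → E) × E => update p.1 j p.2)
        ((Measure.pi fun _ : ι => u).prod u)) := by
    rw [hmap]; exact hG.aestronglyMeasurable
  have hint : Integrable (fun p : (ι → E) × E => G (update p.1 j p.2))
      ((Measure.pi fun _ : ι => u).prod u) := by
    have := (integrable_map_measure hGm measurable_update'.aemeasurable).mp (by rw [hmap]; exact hG)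
    exact this
  calc ∫ X, G X ∂(Measure.pi fun _ : ι => u)
      = ∫ X, G X ∂(Measure.map (fun p : (ι → E) × E => update p.1 j p.2)
          ((Measure.pi fun _ : ι => u).prod u)) := by rw [hmap]
    _ = ∫ p, G (update p.1 j p.2) ∂((Measure.pi fun _ : ι => u).prod u) :=
        integral_map measurable_update'.aemeasurable hGm
    _ = ∫ X, ∫ y, G (update X j y) ∂u ∂(Measure.pi fun _ : ι => u) :=
        integral_prod (fun p : (ι → E) × E => G (update p.1 j p.2)) hint


/-! ### The one-site averaging operator `S` -/

/-- A bounded measurable function on a probability space is integrable. [folklore] -/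
theorem integrable_of_bounded {α : Type*} [MeasurableSpace α] {μ : Measure α} [IsFiniteMeasure μ]
    {G : α → ℝ} (hGm : Measurable G) {C : ℝ} (hGb : ∀ X, |G X| ≤ C) : Integrable G μ :=
  Integrable.of_bound hGm.aestronglyMeasurable C (ae_of_all _ fun X => by
    rw [Real.norm_eq_abs]; exact hGb X)

/-- Sections `y ↦ G(X[j ↦ y])` of a measurable `G` are measurable. [folklore] -/
theorem measurable_section {G : (ι → E) → ℝ} (hGm : Measurable G) (j : ι) (X : ι → E) :
    Measurable fun y => G (update X j y) :=
  hGm.comp (measurable_update X)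

/-- `S j G` only sees the values of `G` on the fibre `{X[j ↦ y]}`. [folklore] -/
theorem S_congr (hS : ∀ j G X, S j G X = ∫ y, G (update X j y) ∂u) {j : ι}
    {G G' : (ι → E) → ℝ} {X : ι → E} (h : ∀ y, G (update X j y) = G' (update X j y)) :
    S j G X = S j G' X := by
  rw [hS, hS]
  exact integral_congr_ae (ae_of_all _ h)

/-- `S j G` does not depend on the `j`-th coordinate. [folklore] -/
theorem S_update (hS : ∀ j G X, S j G X = ∫ y, G (update X j y) ∂u) (j : ι)
    (G : (ι → E) → ℝ) (X : ι → E) (y : E) : S j G (update X j y) = S j G X := by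
  rw [hS, hS]
  simp_rw [update_idem]

/-- `S j G` is measurable for measurable `G`. [folklore] -/
theorem measurable_S [SFinite u] (hS : ∀ j G X, S j G X = ∫ y, G (update X j y) ∂u) (j : ι)
    {G : (ι → E) → ℝ} (hGm : Measurable G) : Measurable (S j G) := by
  have h : S j G = fun X => ∫ y, G (update X j y) ∂u := funext fun X => hS j G X
  rw [h]
  exact ((hGm.comp measurable_update').stronglyMeasurable.integral_prod_right'
    (ν := u)).measurable

/-- `|S j G| ≤ C` if `|G| ≤ C`. [folklore] -/
theorem abs_S_le [IsProbabilityMeasure u] (hS : ∀ j G X, S j G X = ∫ y, G (update X j y) ∂u)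
    (j : ι) {G : (ι → E) → ℝ} {C : ℝ} (hGb : ∀ X, |G X| ≤ C) (X : ι → E) : |S j G X| ≤ C := by
  rw [hS]
  have h := norm_integral_le_of_norm_le_const (μ := u) (f := fun y => G (update X j y)) (C := C)
    (ae_of_all _ fun y => by rw [Real.norm_eq_abs]; exact hGb _)
  rwa [probReal_univ, mul_one, Real.norm_eq_abs] at h

/-- `|S j G| ≤ S j |G|`. [folklore] -/
theorem abs_S_le_S_abs (hS : ∀ j G X, S j G X = ∫ y, G (update X j y) ∂u) (j : ι)
    (G : (ι → E) → ℝ) (X : ι → E) : |S j G X| ≤ S j (fun Y => |G Y|) X := by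
  rw [hS, hS]
  exact abs_integral_le_integral_abs

/-- Monotonicity of `S j` on bounded measurable functions. [folklore] -/
theorem S_mono [IsFiniteMeasure u] (hS : ∀ j G X, S j G X = ∫ y, G (update X j y) ∂u) (j : ι)
    {G G' : (ι → E) → ℝ} (hGm : Measurable G) (hG'm : Measurable G') {C C' : ℝ}
    (hGb : ∀ X, |G X| ≤ C) (hG'b : ∀ X, |G' X| ≤ C') {X : ι → E}
    (h : ∀ y, G (update X j y) ≤ G' (update X j y)) : S j G X ≤ S j G' X := by
  rw [hS, hS]
  exact integral_mono (integrable_of_bounded (measurable_section hGm j X) fun y => hGb _)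
    (integrable_of_bounded (measurable_section hG'm j X) fun y => hG'b _) h

/-- `S j` of a nonnegative function is nonnegative. [folklore] -/
theorem S_nonneg (hS : ∀ j G X, S j G X = ∫ y, G (update X j y) ∂u) (j : ι)
    {G : (ι → E) → ℝ} {X : ι → E} (h : ∀ y, 0 ≤ G (update X j y)) : 0 ≤ S j G X := by
  rw [hS]
  exact integral_nonneg h

/-- A `j`-independent factor comes out of `S j`. [folklore] -/
theorem S_mul_left (hS : ∀ j G X, S j G X = ∫ y, G (update X j y) ∂u) (j : ι)
    {H K : (ι → E) → ℝ} {X : ι → E} (hH : ∀ y, H (update X j y) = H X) :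
    S j (fun Y => H Y * K Y) X = H X * S j K X := by
  rw [hS, hS, ← integral_const_mul]
  exact integral_congr_ae (ae_of_all _ fun y => by simp only [hH])

/-- `S j` of a constant. [folklore] -/
theorem S_const [IsProbabilityMeasure u] (hS : ∀ j G X, S j G X = ∫ y, G (update X j y) ∂u)
    (j : ι) (c : ℝ) (X : ι → E) : S j (fun _ => c) X = c := by
  rw [hS, integral_const, probReal_univ, one_smul]

/-- Additivity of `S j` (bounded measurable functions). [folklore] -/
theorem S_add [IsFiniteMeasure u] (hS : ∀ j G X, S j G X = ∫ y, G (update X j y) ∂u) (j : ι)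
    {G G' : (ι → E) → ℝ} (hGm : Measurable G) (hG'm : Measurable G') {C C' : ℝ}
    (hGb : ∀ X, |G X| ≤ C) (hG'b : ∀ X, |G' X| ≤ C') (X : ι → E) :
    S j (fun Y => G Y + G' Y) X = S j G X + S j G' X := by
  rw [hS, hS, hS]
  exact integral_add (integrable_of_bounded (measurable_section hGm j X) fun y => hGb _)
    (integrable_of_bounded (measurable_section hG'm j X) fun y => hG'b _)

/-- `S j (G - G') = S j G - S j G'` (bounded measurable functions). [folklore] -/
theorem S_sub [IsFiniteMeasure u] (hS : ∀ j G X, S j G X = ∫ y, G (update X j y) ∂u) (j : ι)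
    {G G' : (ι → E) → ℝ} (hGm : Measurable G) (hG'm : Measurable G') {C C' : ℝ}
    (hGb : ∀ X, |G X| ≤ C) (hG'b : ∀ X, |G' X| ≤ C') (X : ι → E) :
    S j (fun Y => G Y - G' Y) X = S j G X - S j G' X := by
  rw [hS, hS, hS]
  exact integral_sub (integrable_of_bounded (measurable_section hGm j X) fun y => hGb _)
    (integrable_of_bounded (measurable_section hG'm j X) fun y => hG'b _)

/-- `S j (c G) = c S j G`. [folklore] -/
theorem S_smul (hS : ∀ j G X, S j G X = ∫ y, G (update X j y) ∂u) (j : ι)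
    (G : (ι → E) → ℝ) (c : ℝ) (X : ι → E) :
    S j (fun Y => c * G Y) X = c * S j G X := by
  rw [hS, hS, integral_const_mul]


/-! ### The heat-bath operator `T j F = S j (F π_j) / S j π_j` -/

variable {π : ι → (ι → E) → ℝ} {T : ι → ((ι → E) → ℝ) → (ι → E) → ℝ}

/-- `T j F` only sees the values of `F` on the fibre `{X[j ↦ y]}`. [folklore] -/
theorem T_congr (hS : ∀ j G X, S j G X = ∫ y, G (update X j y) ∂u)
    (hT : ∀ j F X, T j F X = S j (fun Y => F Y * π j Y) X / S j (π j) X) {j : ι}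
    {F F' : (ι → E) → ℝ} {X : ι → E} (h : ∀ y, F (update X j y) = F' (update X j y)) :
    T j F X = T j F' X := by
  rw [hT, hT, S_congr hS (G' := fun Y => F' Y * π j Y) fun y => by simp only [h]]

/-- `T j F` does not depend on the `j`-th coordinate. [folklore] -/
theorem T_update (hS : ∀ j G X, S j G X = ∫ y, G (update X j y) ∂u)
    (hT : ∀ j F X, T j F X = S j (fun Y => F Y * π j Y) X / S j (π j) X) (j : ι)
    (F : (ι → E) → ℝ) (X : ι → E) (y : E) : T j F (update X j y) = T j F X := by
  rw [hT, hT, S_update hS, S_update hS]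

/-- `T j F` is measurable for measurable `F`. [folklore] -/
theorem measurable_T [SFinite u] (hS : ∀ j G X, S j G X = ∫ y, G (update X j y) ∂u)
    (hT : ∀ j F X, T j F X = S j (fun Y => F Y * π j Y) X / S j (π j) X)
    (hπ : ∀ j, Measurable (π j) ∧ ∀ X, 0 ≤ π j X ∧ π j X ≤ 1) (j : ι)
    {F : (ι → E) → ℝ} (hFm : Measurable F) : Measurable (T j F) := by
  have h : T j F = fun X => S j (fun Y => F Y * π j Y) X / S j (π j) X := funext fun X => hT j F X
  rw [h]
  have hπm := (hπ j).1
  exact (measurable_S hS j (by fun_prop)).div (measurable_S hS j hπm)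

/-- The heat-bath operator is an average: `|T j F| ≤ C` if `|F| ≤ C`. [folklore] -/
theorem abs_T_le [IsProbabilityMeasure u] (hS : ∀ j G X, S j G X = ∫ y, G (update X j y) ∂u)
    (hT : ∀ j F X, T j F X = S j (fun Y => F Y * π j Y) X / S j (π j) X)
    (hπ : ∀ j, Measurable (π j) ∧ ∀ X, 0 ≤ π j X ∧ π j X ≤ 1) (hZ : ∀ j X, 0 < S j (π j) X)
    (j : ι) {F : (ι → E) → ℝ} (hFm : Measurable F) {C : ℝ} (hFb : ∀ X, |F X| ≤ C)
    (X : ι → E) : |T j F X| ≤ C := by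
  have hC : 0 ≤ C := (abs_nonneg _).trans (hFb X)
  rw [hT, abs_div, abs_of_pos (hZ j X), div_le_iff₀ (hZ j X)]
  calc |S j (fun Y => F Y * π j Y) X|
      ≤ S j (fun Y => |F Y * π j Y|) X := abs_S_le_S_abs hS j _ X
    _ ≤ S j (fun Y => C * π j Y) X := by
        have hπm := (hπ j).1
        refine S_mono hS j (G := fun Y => |F Y * π j Y|) (G' := fun Y => C * π j Y)
          (by fun_prop) (by fun_prop) (C := C) (C' := C) (fun Y => ?_) (fun Y => ?_) (fun y => ?_)
        · rw [abs_abs, abs_mul, abs_of_nonneg ((hπ j).2 Y).1]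
          exact (mul_le_mul (hFb Y) ((hπ j).2 Y).2 ((hπ j).2 Y).1 hC).trans (by rw [mul_one])
        · rw [abs_mul, abs_of_nonneg hC, abs_of_nonneg ((hπ j).2 Y).1]
          exact (mul_le_mul_of_nonneg_left ((hπ j).2 Y).2 hC).trans (by rw [mul_one])
        · rw [abs_mul, abs_of_nonneg ((hπ j).2 _).1]
          exact mul_le_mul_of_nonneg_right (hFb _) ((hπ j).2 _).1
    _ = C * S j (π j) X := S_smul hS j (π j) C X

/-- `T j` fixes functions not depending on `x_j`. [folklore] -/
theorem T_fix (hS : ∀ j G X, S j G X = ∫ y, G (update X j y) ∂u)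
    (hT : ∀ j F X, T j F X = S j (fun Y => F Y * π j Y) X / S j (π j) X)
    (hZ : ∀ j X, 0 < S j (π j) X) (j : ι) {g : (ι → E) → ℝ} {X : ι → E}
    (hg : ∀ y, g (update X j y) = g X) : T j g X = g X := by
  rw [hT, S_mul_left hS j hg, mul_div_assoc, div_self (hZ j X).ne', mul_one]

/-- A `j`-independent factor comes out of `T j`. [folklore] -/
theorem T_mul_left (hS : ∀ j G X, S j G X = ∫ y, G (update X j y) ∂u)
    (hT : ∀ j F X, T j F X = S j (fun Y => F Y * π j Y) X / S j (π j) X) (j : ι)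
    {g F : (ι → E) → ℝ} {X : ι → E} (hg : ∀ y, g (update X j y) = g X) :
    T j (fun Y => g Y * F Y) X = g X * T j F X := by
  rw [hT, hT, mul_div_assoc', ← S_mul_left hS j hg]
  simp only [mul_assoc]

/-- `T j (F - F') = T j F - T j F'` (bounded measurable functions). [folklore] -/
theorem T_sub [IsFiniteMeasure u] (hS : ∀ j G X, S j G X = ∫ y, G (update X j y) ∂u)
    (hT : ∀ j F X, T j F X = S j (fun Y => F Y * π j Y) X / S j (π j) X)
    (hπ : ∀ j, Measurable (π j) ∧ ∀ X, 0 ≤ π j X ∧ π j X ≤ 1) (j : ι)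
    {F F' : (ι → E) → ℝ} (hFm : Measurable F) (hF'm : Measurable F') {C C' : ℝ}
    (hFb : ∀ X, |F X| ≤ C) (hF'b : ∀ X, |F' X| ≤ C') (X : ι → E) :
    T j (fun Y => F Y - F' Y) X = T j F X - T j F' X := by
  rw [hT, hT, hT, ← sub_div]
  congr 1
  have hπm := (hπ j).1
  have h := S_sub hS j (G := fun Y => F Y * π j Y) (G' := fun Y => F' Y * π j Y)
    (by fun_prop) (by fun_prop) (C := C) (C' := C') (fun Y => ?_) (fun Y => ?_) X
  · rw [← h]; congr 1; funext Y; ring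
  · rw [abs_mul, abs_of_nonneg ((hπ j).2 Y).1]
    exact (mul_le_mul (hFb Y) ((hπ j).2 Y).2 ((hπ j).2 Y).1
      ((abs_nonneg _).trans (hFb Y))).trans (by rw [mul_one])
  · rw [abs_mul, abs_of_nonneg ((hπ j).2 Y).1]
    exact (mul_le_mul (hF'b Y) ((hπ j).2 Y).2 ((hπ j).2 Y).1
      ((abs_nonneg _).trans (hF'b Y))).trans (by rw [mul_one])

/-- `T j (F + F') = T j F + T j F'` (bounded measurable functions). [folklore] -/
theorem T_add [IsFiniteMeasure u] (hS : ∀ j G X, S j G X = ∫ y, G (update X j y) ∂u)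
    (hT : ∀ j F X, T j F X = S j (fun Y => F Y * π j Y) X / S j (π j) X)
    (hπ : ∀ j, Measurable (π j) ∧ ∀ X, 0 ≤ π j X ∧ π j X ≤ 1) (j : ι)
    {F F' : (ι → E) → ℝ} (hFm : Measurable F) (hF'm : Measurable F') {C C' : ℝ}
    (hFb : ∀ X, |F X| ≤ C) (hF'b : ∀ X, |F' X| ≤ C') (X : ι → E) :
    T j (fun Y => F Y + F' Y) X = T j F X + T j F' X := by
  rw [hT, hT, hT, ← add_div]
  congr 1
  have hπm := (hπ j).1
  have h := S_add hS j (G := fun Y => F Y * π j Y) (G' := fun Y => F' Y * π j Y)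
    (by fun_prop) (by fun_prop) (C := C) (C' := C') (fun Y => ?_) (fun Y => ?_) X
  · rw [← h]; congr 1; funext Y; ring
  · rw [abs_mul, abs_of_nonneg ((hπ j).2 Y).1]
    exact (mul_le_mul (hFb Y) ((hπ j).2 Y).2 ((hπ j).2 Y).1
      ((abs_nonneg _).trans (hFb Y))).trans (by rw [mul_one])
  · rw [abs_mul, abs_of_nonneg ((hπ j).2 Y).1]
    exact (mul_le_mul (hF'b Y) ((hπ j).2 Y).2 ((hπ j).2 Y).1
      ((abs_nonneg _).trans (hF'b Y))).trans (by rw [mul_one])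

/-- `T j (c F) = c T j F`. [folklore] -/
theorem T_smul (hS : ∀ j G X, S j G X = ∫ y, G (update X j y) ∂u)
    (hT : ∀ j F X, T j F X = S j (fun Y => F Y * π j Y) X / S j (π j) X) (j : ι)
    (F : (ι → E) → ℝ) (c : ℝ) (X : ι → E) : T j (fun Y => c * F Y) X = c * T j F X := by
  rw [hT, hT, mul_div_assoc', ← S_smul hS j]
  simp only [mul_assoc]

/-- `T j c = c` for a constant `c`. [folklore] -/
theorem T_const (hS : ∀ j G X, S j G X = ∫ y, G (update X j y) ∂u)
    (hT : ∀ j F X, T j F X = S j (fun Y => F Y * π j Y) X / S j (π j) X)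
    (hZ : ∀ j X, 0 < S j (π j) X) (j : ι) (c : ℝ) (X : ι → E) :
    T j (fun _ => c) X = c :=
  T_fix hS hT hZ j (g := fun _ => c) fun _ => rfl

/-- `T j (F - c) = T j F - c` for a constant `c`. [folklore] -/
theorem T_sub_const [IsFiniteMeasure u] (hS : ∀ j G X, S j G X = ∫ y, G (update X j y) ∂u)
    (hT : ∀ j F X, T j F X = S j (fun Y => F Y * π j Y) X / S j (π j) X)
    (hπ : ∀ j, Measurable (π j) ∧ ∀ X, 0 ≤ π j X ∧ π j X ≤ 1) (hZ : ∀ j X, 0 < S j (π j) X)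
    (j : ι) {F : (ι → E) → ℝ} (hFm : Measurable F) {C : ℝ} (hFb : ∀ X, |F X| ≤ C) (c : ℝ)
    (X : ι → E) : T j (fun Y => F Y - c) X = T j F X - c := by
  rw [T_sub hS hT hπ j hFm measurable_const hFb (fun _ => le_refl |c|) X, T_const hS hT hZ]

end JastrowDobrushin

end Summit.AtomisticToContinuum.BoseEinsteinCondensation.Theorems
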